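import Summits.CriticalPhenomena.PercolationContinuityZ3.Theorems.PercNearOneGluingNoHeavyLowerTailIncStarTwoCutFarPatterns
import Summits.CriticalPhenomena.PercolationContinuityZ3.Theorems.PercNearOneGluingNoHeavyLowerTailIncStarTwoCutFXSemantics
import Literature.Probability.Percolation.BergKahnLogSupermodular
import Literature.Probability.Percolation.FourFunctionsProdBernoulli
import Literature.Probability.Percolation.SlabCriticality
import Literature.Probability.LatticeModels.ProdBernoulliIndependence
import Literature.Probability.LatticeModels.SahiThirdOrderCorrelation
import HarnessLib

/-!
# MODE B, XIX: the far-cell row layer — every VALID certificate row is nonnegative on the far cell law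

Support file for the Sahi programme (`--supports stmt-CriticalPhenomena-4575`, prover prim-sahi-p2 gen 28).  No sorries, no named facts,
no `native_decide`.  The rows of the (FX)/(FY) certificates (`…IncStarTwoCutFXCertKernel`, data `…FXCertData*`, `…FYCertData*`) are
`prod P Q R S` = `m(P)m(Q) − m(R)m(S)` and `e3 A B C` rows over the 15 far cells of `(x,y,b,c)` inside a vertex set `U`
(`…IncStarTwoCutFarPatterns`), plus `c_q`-multiples and monomials.  `FRow.valid` (decidable) accepts:
* `prod`/`prodcq` rows that are FOUR-EVENTS instances (`adOK`: `P` contains every pattern below the meet and `Q` every pattern above the join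
  of a pattern of `R` and a pattern of `S` — Ahlswede–Daykin, `prodBernoulli_fourEvents`), or van den Berg–Häggström–Kahn Thm 1.1 instances
  inside `U` (`bhkTab`: root `r`, two monotone families of `C_r ∩ {x,y,b,c}` given by minimal sets, avoided label sets `X, Y` —
  `BergKahn.bhk_aux`, via the bridge `reachIn_iff_openConnIn`);
* `e3 full B C` with `B, C` up-closed (`σ·(σ m(B∩C) − m(B)m(C))`, Harris) and the two FAR STARS `e3 (x~y) (x~b) (x~c)`, `e3 (y~x) (y~b) (y~c)`
  (`= E₃` of the connection events inside `U` — HYPOTHESES, inductively available);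
* `one`, `onecq` (the latter needs `c_q ≥ 0`, Harris on the near class law — a hypothesis here).
Main: `frowVal_nonneg_of_valid` on the valuation `val19 (fcellLaw U x y b c w) q0 qX qY qW`.
-/

namespace Summit.CriticalPhenomena.PercolationContinuityZ3.Theorems

namespace IncStarTwoCut.FarCert

open MeasureTheory Finset Literature.Probability.Percolation Literature.Probability.LatticeModels FourPointCert IncStarTwoCut.FXCert
open scoped Classical

/-! ### Decidable validity -/

/-- Four-events condition: for patterns `π₁ ∈ R`, `π₂ ∈ S`, every pattern whose joined pairs lie in `joined π₁ ∩ joined π₂` is in `P`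
and every pattern whose joined pairs contain `joined π₁ ∪ joined π₂` is in `Q`. [this work] -/
def adOK (P Q R S : ℕ) : Bool :=
  (List.range 15).all fun π₁ => !R.testBit π₁ || (List.range 15).all fun π₂ => !S.testBit π₂ ||
    (List.range 15).all fun π' =>
      (!((List.range 6).all fun k => !fjoined π' k || (fjoined π₁ k && fjoined π₂ k)) || P.testBit π') &&
      (!((List.range 6).all fun k => !(fjoined π₁ k || fjoined π₂ k) || fjoined π' k) || Q.testBit π')

/-- Monotone family of the root cluster given by minimal label sets (4-bit masks): some `m ∈ mins` has all its labels joined to `r`. [this work] -/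
def famB (mins : List ℕ) (r π : ℕ) : Bool := mins.any fun m => (List.range 4).all fun t => !m.testBit t || fjn π r t

/-- Avoidance: no label of the 4-bit mask `X` is joined to `r`. [this work] -/
def sepB (X r π : ℕ) : Bool := (List.range 4).all fun t => !X.testBit t || !fjn π r t

/-- The four masks `(P, Q, R, S)` of a BHK Thm 1.1 instance: `R = {𝒰₁, r ↛ X}`, `S = {𝒰₂, r ↛ Y}`, `P = {𝒰₁, 𝒰₂, r ↛ X ∩ Y}`, `Q = {r ↛ X ∪ Y}`. [this work] -/
def bhkMasks (r : ℕ) (mins₁ mins₂ : List ℕ) (X Y : ℕ) : ℕ × ℕ × ℕ × ℕ :=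
  (maskOf fun π => famB mins₁ r π && famB mins₂ r π && sepB (X &&& Y) r π, maskOf fun π => sepB (X ||| Y) r π,
    maskOf fun π => famB mins₁ r π && sepB X r π, maskOf fun π => famB mins₂ r π && sepB Y r π)

/-- The BHK Thm 1.1 instances used by the (FX)/(FY) certificates: `(root, mins₁, mins₂, X, Y)`. [this work] -/
def bhkTab : List (ℕ × List ℕ × List ℕ × ℕ × ℕ) :=
  [(1, [5,12], [9,12], 0, 0), (1, [0], [5,12], 0, 8), (1, [0], [9,12], 0, 4), (0, [0], [2], 4, 8), (1, [0], [1], 8, 4), (1, [0], [1,12], 8, 4),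
   (1, [0], [1,12], 0, 8), (1, [0], [8], 1, 4), (1, [0], [1,8], 8, 4), (1, [0], [1,8], 1, 8), (0, [0], [6,12], 0, 8), (0, [0], [10,12], 0, 4),
   (0, [0], [2,12], 8, 4), (0, [0], [4], 2, 8), (0, [0], [2,4], 4, 8), (0, [0], [2,4], 2, 4), (1, [0], [4,9], 4, 8), (1, [0], [1,4], 4, 8),
   (1, [0], [1,4], 1, 4), (1, [0], [1,4], 1, 8), (1, [4,8], [4,8], 4, 8), (1, [0], [4,8], 4, 1), (1, [0], [4,8], 8, 1), (0, [0], [2,8], 8, 4),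
   (0, [0], [2,8], 2, 8), (0, [0], [2,8], 2, 4), (0, [4,8], [4,8], 4, 8), (0, [0], [4,8], 8, 2), (0, [0], [4,8], 4, 2)]

/-- Validity of a product row: a four-events instance or a tabulated BHK Thm 1.1 instance. [this work] -/
def prodValid (P Q R S : ℕ) : Bool :=
  adOK P Q R S || bhkTab.any fun e => decide (e.1 < 4) && bhkMasks e.1 e.2.1 e.2.2.1 e.2.2.2.1 e.2.2.2.2 == (P, Q, R, S)

/-- The two far stars as mask triples: `(x~y, x~b, x~c)` and `(y~x, y~b, y~c)`. [this work] -/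
def starRows : List (ℕ × ℕ × ℕ) := [(fconnMask 0 1, fconnMask 0 2, fconnMask 0 3), (fconnMask 1 0, fconnMask 1 2, fconnMask 1 3)]

/-- **Validity of a certificate row** (decidable). [this work] -/
def _root_.Summit.CriticalPhenomena.PercolationContinuityZ3.Theorems.IncStarTwoCut.FXCert.FRow.valid : FRow → Bool
  | .one => true
  | .onecq => true
  | .prod P Q R S => prodValid P Q R S
  | .prodcq P Q R S => prodValid P Q R S
  | .e3 A B C => (A == full && fisUp B && fisUp C) || starRows.any fun t => t == (A, B, C)

variable {V : Type} [Fintype V] [DecidableEq V] (U : Finset V) (x y b c : V) (w : Sym2 V → unitInterval)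

/-! ### Four-events rows -/

/-- One implication step of `adOK`: if the Boolean premise list holds, the disjunction yields the conclusion. [this work] -/
theorem or_resolve_all {A c : Bool} (h : A = false ∨ c = true) (hA : A = true) : c = true := by
  rcases h with h | h
  · rw [hA] at h; exact absurd h (by decide)
  · exact h

/-- `adOK` unpacked. [this work] -/
theorem adOK_spec {P Q R S : ℕ} (h : adOK P Q R S = true) {π₁ π₂ π' : ℕ} (h₁ : π₁ < 15) (h₂ : π₂ < 15) (h' : π' < 15)
    (hR : R.testBit π₁ = true) (hS : S.testBit π₂ = true) :
    ((∀ k < 6, fjoined π' k = true → fjoined π₁ k = true ∧ fjoined π₂ k = true) → P.testBit π' = true) ∧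
      ((∀ k < 6, (fjoined π₁ k = true ∨ fjoined π₂ k = true) → fjoined π' k = true) → Q.testBit π' = true) := by
  simp only [adOK, List.all_eq_true, List.mem_range, Bool.or_eq_true, Bool.not_eq_true', Bool.and_eq_true] at h
  rcases h π₁ h₁ with hR' | h
  · rw [hR'] at hR; exact absurd hR Bool.false_ne_true
  rcases h π₂ h₂ with hS' | h
  · rw [hS'] at hS; exact absurd hS Bool.false_ne_true
  obtain ⟨hP, hQ⟩ := h π' h'
  constructor
  · intro hk
    refine or_resolve_all hP ?_
    rw [List.all_eq_true]
    intro k hk6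
    rw [List.mem_range] at hk6
    cases hj : fjoined π' k
    · rfl
    · obtain ⟨e1, e2⟩ := hk k hk6 hj
      simp only [e1, e2, Bool.not_true, Bool.and_self, Bool.or_true]
  · intro hk
    refine or_resolve_all hQ ?_
    rw [List.all_eq_true]
    intro k hk6
    rw [List.mem_range] at hk6
    cases hj : (fjoined π₁ k || fjoined π₂ k)
    · rfl
    · have := hk k hk6 (by rcases Bool.or_eq_true_iff.1 hj with e | e; exact Or.inl e; exact Or.inr e)
      simp only [this, Bool.not_true, Bool.or_true]

omit [DecidableEq V] in
/-- **Four-events rows**: `m(R)m(S) ≤ m(P)m(Q)` under `adOK P Q R S` (Ahlswede–Daykin on the bond lattice: the far pattern of `ω ∩ ω′`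
is below both patterns, that of `ω ∪ ω′` above both). [this work] -/
theorem prod_row_of_adOK {P Q R S : ℕ} (h : adOK P Q R S = true) :
    msum R (fcellLaw (↑U) x y b c w) * msum S (fcellLaw (↑U) x y b c w) ≤ msum P (fcellLaw (↑U) x y b c w) * msum Q (fcellLaw (↑U) x y b c w) := by
  rw [← real_fpre, ← real_fpre, ← real_fpre, ← real_fpre]
  refine prodBernoulli_fourEvents w _ _ _ _ fun a ha a' ha' => ?_
  rw [mem_fpre] at ha ha'
  have hsp := adOK_spec h (fpat_lt (↑U : Set V) x y b c a) (fpat_lt (↑U : Set V) x y b c a') (fpat_lt (↑U : Set V) x y b c (a ∩ a')) ha ha'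
  have hsp' := adOK_spec h (fpat_lt (↑U : Set V) x y b c a) (fpat_lt (↑U : Set V) x y b c a') (fpat_lt (↑U : Set V) x y b c (a ∪ a')) ha ha'
  have l1 : a ∩ a' ≤ a := fun e he => he.1
  have l2 : a ∩ a' ≤ a' := fun e he => he.2
  have l3 : a ≤ a ∪ a' := fun e he => Or.inl he
  have l4 : a' ≤ a ∪ a' := fun e he => Or.inr he
  rw [mem_fpre, mem_fpre]
  refine ⟨hsp.1 fun k hk hj => ⟨fjoined_fpat_mono (↑U : Set V) x y b c l1 hk hj, fjoined_fpat_mono (↑U : Set V) x y b c l2 hk hj⟩,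
    hsp'.2 fun k hk hj => ?_⟩
  rcases hj with hj | hj
  · exact fjoined_fpat_mono (↑U : Set V) x y b c l3 hk hj
  · exact fjoined_fpat_mono (↑U : Set V) x y b c l4 hk hj

/-! ### Harris rows and the far stars -/

/-- `e3 full B C` is `σ·(σ m(B ∩ C) − m(B)m(C))`. [this work] -/
theorem e3val_full (f : ℕ → ℝ) (B C : ℕ) : e3val full B C f = msum full f * (msum full f * msum (B &&& C) f - msum B f * msum C f) := by
  simp only [e3val, Nat.and_assoc, msum_full_and]
  ring

omit [DecidableEq V] in
/-- **Harris rows** `e3 full B C ≥ 0` for up-closed `B, C`. [this work] -/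
theorem e3_full_row_nonneg {B C : ℕ} (hB : fisUp B = true) (hC : fisUp C = true) : 0 ≤ e3val full B C (fcellLaw (↑U) x y b c w) := by
  have h := prodBernoulli_harris w (isUpperSet_fpre (↑U) x y b c hB) (isUpperSet_fpre (↑U) x y b c hC) (measurableSet_of_fintype _)
    (measurableSet_of_fintype _)
  rw [← fpre_and, real_fpre, real_fpre, real_fpre] at h
  rw [e3val_full, msum_full_fcellLaw, one_mul, one_mul]
  linarith

omit [DecidableEq V] in
/-- **The cubic of three masks is `E₃` of the three mask events.** [this work] -/
theorem e3val_eq_sahiE3 (A B C : ℕ) : e3val A B C (fcellLaw (↑U) x y b c w) =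
    sahiE3 (prodBernoulli w) (fpre (↑U) x y b c A) (fpre (↑U) x y b c B) (fpre (↑U) x y b c C) := by
  rw [sahiE3_def]
  simp only [← fpre_and, real_fpre, e3val, msum_full_fcellLaw]
  ring

omit [DecidableEq V] in
/-- **Star rows**: the tabulated far stars are `E₃` of the connection events inside `U`. [this work] -/
theorem e3_star_row {A B C : ℕ} (h : (starRows.any fun t => t == (A, B, C)) = true)
    (hS0 : 0 ≤ sahiE3 (prodBernoulli w) (openConnIn (↑U : Set V) x y) (openConnIn (↑U : Set V) x b) (openConnIn (↑U : Set V) x c))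
    (hS1 : 0 ≤ sahiE3 (prodBernoulli w) (openConnIn (↑U : Set V) y x) (openConnIn (↑U : Set V) y b) (openConnIn (↑U : Set V) y c)) :
    0 ≤ e3val A B C (fcellLaw (↑U) x y b c w) := by
  simp only [starRows, List.any_cons, List.any_nil, Bool.or_false, Bool.or_eq_true, beq_iff_eq, Prod.mk.injEq] at h
  rcases h with ⟨rfl, rfl, rfl⟩ | ⟨rfl, rfl, rfl⟩
  · rw [e3val_eq_sahiE3, fpre_fconnMask _ _ _ _ _ (by norm_num) (by norm_num) (by norm_num),
      fpre_fconnMask _ _ _ _ _ (by norm_num) (by norm_num) (by norm_num), fpre_fconnMask _ _ _ _ _ (by norm_num) (by norm_num) (by norm_num)]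
    exact hS0
  · rw [e3val_eq_sahiE3, fpre_fconnMask _ _ _ _ _ (by norm_num) (by norm_num) (by norm_num),
      fpre_fconnMask _ _ _ _ _ (by norm_num) (by norm_num) (by norm_num), fpre_fconnMask _ _ _ _ _ (by norm_num) (by norm_num) (by norm_num)]
    exact hS1

/-! ### BHK Thm 1.1 rows inside `U` -/

omit [Fintype V] [DecidableEq V] in
/-- **Bridge**: reachability by open edges inside `U` (`BergKahn.ReachIn`) is the connection event inside `↑U` (root in `U`). [this work] -/
theorem reachIn_iff_openConnIn {ω : BondConfig V} {s t : V} (hs : s ∈ U) :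
    BergKahn.ReachIn U ω s t ↔ ω ∈ openConnIn (↑U : Set V) s t := by
  rw [mem_openConnIn_iff_pathIn]
  constructor
  · intro h
    refine ⟨Finset.mem_coe.2 hs, ?_⟩
    have h' := (SimpleGraph.reachable_iff_reflTransGen _ _).1 h
    clear h
    induction h' with
    | refl => exact Relation.ReflTransGen.refl
    | tail _ hbc ih =>
      obtain ⟨hmem, hne⟩ := (openGraph_adj _ _ _).1 hbc
      exact ih.tail ⟨(openGraph_adj ω _ _).2 ⟨hmem.1, hne⟩, Finset.mem_coe.2 (hmem.2 _ (Sym2.mem_mk_right _ _))⟩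
  · rintro ⟨-, h⟩
    induction h with
    | refl => exact SimpleGraph.Reachable.refl _
    | @tail p q hsp hpq ih =>
      have hp : p ∈ (↑U : Set V) := PathIn.right_mem ⟨Finset.mem_coe.2 hs, hsp⟩
      refine ih.trans (SimpleGraph.Adj.reachable ?_)
      obtain ⟨hω, hne⟩ := (openGraph_adj ω p q).1 hpq.1
      refine (openGraph_adj _ p q).2 ⟨⟨hω, fun v hv => ?_⟩, hne⟩
      rcases Sym2.mem_iff.1 hv with rfl | rfl
      · exact Finset.mem_coe.1 hp
      · exact Finset.mem_coe.1 hpq.2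

/-- The label set of a 4-bit mask (labels `0=x,1=y,2=b,3=c`). [this work] -/
def flabSet (X : ℕ) : Finset V := ((Finset.range 4).filter fun u => X.testBit u = true).image (lab x y b c)

omit [Fintype V] in
/-- Membership in `flabSet`. [this work] -/
theorem mem_flabSet {X : ℕ} {v : V} : v ∈ flabSet x y b c X ↔ ∃ u < 4, X.testBit u = true ∧ lab x y b c u = v := by
  simp only [flabSet, Finset.mem_image, Finset.mem_filter, Finset.mem_range]
  exact ⟨fun ⟨u, ⟨hu, hX⟩, hv⟩ => ⟨u, hu, hX, hv⟩, fun ⟨u, hu, hX, hv⟩ => ⟨u, ⟨hu, hX⟩, hv⟩⟩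

variable {U x y b c}

omit [Fintype V] [DecidableEq V] in
/-- `fjn` on the far pattern is reachability inside `U` from a root label in `U` (coincident labels allowed). [this work] -/
theorem fjn_fpat_iff_reachIn (hlab : ∀ i < 4, lab x y b c i ∈ U) (ω : BondConfig V) {r t : ℕ} (hr : r < 4) (ht : t < 4) :
    fjn (fpat (↑U) x y b c ω) r t = true ↔ BergKahn.ReachIn U ω (lab x y b c r) (lab x y b c t) := by
  have h1 : BergKahn.ReachIn U ω (lab x y b c r) (lab x y b c t) ↔ ω ∈ openConnIn (↑U : Set V) (lab x y b c r) (lab x y b c t) :=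
    reachIn_iff_openConnIn U (hlab r hr)
  have h2 := fjn_fpat_iff (↑U : Set V) x y b c ω hr ht (Or.inr (Finset.mem_coe.2 (hlab r hr)))
  exact h2.trans h1.symm

omit [Fintype V] [DecidableEq V] in
/-- Semantics of `famB`. [this work] -/
theorem famB_iff (hlab : ∀ i < 4, lab x y b c i ∈ U) (ω : BondConfig V) {r : ℕ} (hr : r < 4) (mins : List ℕ) :
    famB mins r (fpat (↑U) x y b c ω) = true ↔
      ∃ m ∈ mins, ∀ t < 4, m.testBit t = true → BergKahn.ReachIn U ω (lab x y b c r) (lab x y b c t) := by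
  simp only [famB, List.any_eq_true, List.all_eq_true, List.mem_range, Bool.or_eq_true, Bool.not_eq_true']
  constructor
  · rintro ⟨m, hm, h⟩
    refine ⟨m, hm, fun t ht hb => ?_⟩
    rcases h t ht with h | h
    · rw [h] at hb; exact absurd hb Bool.false_ne_true
    · exact (fjn_fpat_iff_reachIn hlab ω hr ht).1 h
  · rintro ⟨m, hm, h⟩
    refine ⟨m, hm, fun t ht => ?_⟩
    rcases Bool.eq_false_or_eq_true (m.testBit t) with hb | hb
    · exact Or.inr ((fjn_fpat_iff_reachIn hlab ω hr ht).2 (h t ht hb))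
    · exact Or.inl hb

omit [Fintype V] in
/-- Semantics of `sepB`. [this work] -/
theorem sepB_iff (hlab : ∀ i < 4, lab x y b c i ∈ U) (ω : BondConfig V) {r : ℕ} (hr : r < 4) (X : ℕ) :
    sepB X r (fpat (↑U) x y b c ω) = true ↔ ∀ v ∈ (↑(flabSet x y b c X) : Set V), ¬ BergKahn.ReachIn U ω (lab x y b c r) v := by
  simp only [sepB, List.all_eq_true, List.mem_range, Bool.or_eq_true, Bool.not_eq_true', Finset.mem_coe, mem_flabSet]
  constructor
  · rintro h v ⟨t, ht, hX, rfl⟩ hreach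
    rcases h t ht with h | h
    · rw [h] at hX; exact absurd hX Bool.false_ne_true
    · rw [(fjn_fpat_iff_reachIn hlab ω hr ht).2 hreach] at h; exact absurd h (by decide)
  · intro h t ht
    rcases Bool.eq_false_or_eq_true (X.testBit t) with hb | hb
    · right
      rw [Bool.eq_false_iff]
      intro hj
      exact h _ ⟨t, ht, hb, rfl⟩ ((fjn_fpat_iff_reachIn hlab ω hr ht).1 hj)
    · exact Or.inl hb

omit [Fintype V] in
/-- `flabSet` of a union of masks. [this work] -/
theorem flabSet_or (X Y : ℕ) : flabSet x y b c (X ||| Y) = flabSet x y b c X ∪ flabSet x y b c Y := by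
  ext v
  simp only [Finset.mem_union, mem_flabSet, Nat.testBit_or, Bool.or_eq_true]
  constructor
  · rintro ⟨u, hu, hX | hY, hv⟩
    · exact Or.inl ⟨u, hu, hX, hv⟩
    · exact Or.inr ⟨u, hu, hY, hv⟩
  · rintro (⟨u, hu, hX, hv⟩ | ⟨u, hu, hY, hv⟩)
    · exact ⟨u, hu, Or.inl hX, hv⟩
    · exact ⟨u, hu, Or.inr hY, hv⟩

omit [Fintype V] in
/-- `flabSet` of an intersection of masks lies in the intersection. [this work] -/
theorem flabSet_and_subset (X Y : ℕ) : flabSet x y b c (X &&& Y) ⊆ flabSet x y b c X ∩ flabSet x y b c Y := by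
  intro v hv
  rw [mem_flabSet] at hv
  obtain ⟨u, hu, hXY, rfl⟩ := hv
  rw [Nat.testBit_and, Bool.and_eq_true] at hXY
  exact Finset.mem_inter.2 ⟨(mem_flabSet x y b c).2 ⟨u, hu, hXY.1, rfl⟩, (mem_flabSet x y b c).2 ⟨u, hu, hXY.2, rfl⟩⟩

/-- **BHK Thm 1.1 rows inside `U`**: for a root label `r`, monotone families given by `mins₁, mins₂` and avoided masks `X, Y`,
`m(R)m(S) ≤ m(P)m(Q)` for `(P,Q,R,S) = bhkMasks r mins₁ mins₂ X Y` (all four labels in `U`). [this work] -/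
theorem prod_row_of_bhk (hlab : ∀ i < 4, lab x y b c i ∈ U) {r : ℕ} (hr : r < 4) (mins₁ mins₂ : List ℕ) (X Y : ℕ) :
    msum (bhkMasks r mins₁ mins₂ X Y).2.2.1 (fcellLaw (↑U) x y b c w) * msum (bhkMasks r mins₁ mins₂ X Y).2.2.2 (fcellLaw (↑U) x y b c w) ≤
      msum (bhkMasks r mins₁ mins₂ X Y).1 (fcellLaw (↑U) x y b c w) * msum (bhkMasks r mins₁ mins₂ X Y).2.1 (fcellLaw (↑U) x y b c w) := by
  simp only [bhkMasks]
  rw [← real_fpre, ← real_fpre, ← real_fpre, ← real_fpre]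
  set s := lab x y b c r with hs
  have hsU : s ∈ U := hlab r hr
  set 𝒰₁ : Set V → Prop := fun T => ∃ m ∈ mins₁, ∀ t < 4, m.testBit t = true → lab x y b c t ∈ T with h𝒰₁
  set 𝒰₂ : Set V → Prop := fun T => ∃ m ∈ mins₂, ∀ t < 4, m.testBit t = true → lab x y b c t ∈ T with h𝒰₂
  have mono : ∀ mins : List ℕ, Monotone (fun T : Set V => ∃ m ∈ mins, ∀ t < 4, m.testBit t = true → lab x y b c t ∈ T) :=
    fun mins T T' hTT' ⟨m, hm, h⟩ => ⟨m, hm, fun t ht hb => hTT' (h t ht hb)⟩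
  have hXU : flabSet x y b c X ⊆ U := fun v hv => by
    obtain ⟨u, hu, -, rfl⟩ := (mem_flabSet x y b c).1 hv; exact hlab u hu
  have hYU : flabSet x y b c Y ⊆ U := fun v hv => by
    obtain ⟨u, hu, -, rfl⟩ := (mem_flabSet x y b c).1 hv; exact hlab u hu
  have key := BergKahn.bhk_aux w U.card U rfl hsU (mono mins₁) (mono mins₂) hXU hYU
  -- identification of the four events
  have eR : BergKahn.reachFam U s (fun T => ∃ m ∈ mins₁, ∀ t < 4, m.testBit t = true → lab x y b c t ∈ T) ∩
      BergKahn.avoidIn U s ↑(flabSet x y b c X) = fpre (↑U) x y b c (maskOf fun π => famB mins₁ r π && sepB X r π) := by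
    ext ω
    rw [mem_fpre_maskOf, Bool.and_eq_true, famB_iff hlab ω hr, sepB_iff hlab ω hr]
    rfl
  have eS : BergKahn.reachFam U s (fun T => ∃ m ∈ mins₂, ∀ t < 4, m.testBit t = true → lab x y b c t ∈ T) ∩
      BergKahn.avoidIn U s ↑(flabSet x y b c Y) = fpre (↑U) x y b c (maskOf fun π => famB mins₂ r π && sepB Y r π) := by
    ext ω
    rw [mem_fpre_maskOf, Bool.and_eq_true, famB_iff hlab ω hr, sepB_iff hlab ω hr]
    rfl
  have eQ : BergKahn.avoidIn U s ↑(flabSet x y b c X ∪ flabSet x y b c Y) = fpre (↑U) x y b c (maskOf fun π => sepB (X ||| Y) r π) := by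
    ext ω
    rw [mem_fpre_maskOf, sepB_iff hlab ω hr, flabSet_or]
    rfl
  have eP : BergKahn.reachFam U s (fun T => (∃ m ∈ mins₁, ∀ t < 4, m.testBit t = true → lab x y b c t ∈ T) ∧
        (∃ m ∈ mins₂, ∀ t < 4, m.testBit t = true → lab x y b c t ∈ T)) ∩ BergKahn.avoidIn U s ↑(flabSet x y b c X ∩ flabSet x y b c Y) ⊆
      fpre (↑U) x y b c (maskOf fun π => famB mins₁ r π && famB mins₂ r π && sepB (X &&& Y) r π) := by
    intro ω hω
    rw [mem_fpre_maskOf, Bool.and_eq_true, Bool.and_eq_true, famB_iff hlab ω hr, famB_iff hlab ω hr, sepB_iff hlab ω hr]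
    obtain ⟨⟨h1, h2⟩, h3⟩ := hω
    exact ⟨⟨h1, h2⟩, fun v hv => h3 v (Finset.mem_coe.2 (flabSet_and_subset X Y (Finset.mem_coe.1 hv)))⟩
  rw [eR, eS, eQ] at key
  exact key.trans (mul_le_mul_of_nonneg_right (measureReal_mono eP) measureReal_nonneg)

/-- **Product rows**: `m(R)m(S) ≤ m(P)m(Q)` for every valid product row. [this work] -/
theorem prod_row_of_valid (hlab : ∀ i < 4, lab x y b c i ∈ U) {P Q R S : ℕ} (h : prodValid P Q R S = true) :
    msum R (fcellLaw (↑U) x y b c w) * msum S (fcellLaw (↑U) x y b c w) ≤ msum P (fcellLaw (↑U) x y b c w) * msum Q (fcellLaw (↑U) x y b c w) := by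
  rw [prodValid, Bool.or_eq_true] at h
  rcases h with h | h
  · exact prod_row_of_adOK U x y b c w h
  · rw [List.any_eq_true] at h
    obtain ⟨e, -, he⟩ := h
    rw [Bool.and_eq_true, decide_eq_true_eq, beq_iff_eq] at he
    obtain ⟨hr, he⟩ := he
    have k := prod_row_of_bhk (w := w) hlab hr e.2.1 e.2.2.1 e.2.2.2.1 e.2.2.2.2
    rw [he] at k
    exact k

/-! ### Main: valid rows are nonnegative -/

/-- **Every valid row is nonnegative** on the valuation `val19 (far cell law inside U) q0 qX qY qW`, given `c_q ≥ 0` and the two far stars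
(all four labels in `U`; coincidences allowed). [this work] -/
theorem frowVal_nonneg_of_valid (hlab : ∀ i < 4, lab x y b c i ∈ U) {q0 qX qY qW : ℝ}
    (hcq : 0 ≤ qW * (q0 + qX + qY + qW) - (qX + qW) * (qY + qW))
    (hS0 : 0 ≤ sahiE3 (prodBernoulli w) (openConnIn (↑U : Set V) x y) (openConnIn (↑U : Set V) x b) (openConnIn (↑U : Set V) x c))
    (hS1 : 0 ≤ sahiE3 (prodBernoulli w) (openConnIn (↑U : Set V) y x) (openConnIn (↑U : Set V) y b) (openConnIn (↑U : Set V) y c))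
    (r : FRow) (hr : r.valid = true) : 0 ≤ frowVal r (val19 (fcellLaw (↑U) x y b c w) q0 qX qY qW) := by
  cases r with
  | one => exact zero_le_one
  | onecq => rw [frowVal, cqVal_val19]; exact hcq
  | prod P Q R S =>
    simp only [frowVal, msum_val19]
    exact sub_nonneg.2 (prod_row_of_valid (w := w) hlab hr)
  | prodcq P Q R S =>
    simp only [frowVal, msum_val19, cqVal_val19]
    exact mul_nonneg (sub_nonneg.2 (prod_row_of_valid (w := w) hlab hr)) hcq
  | e3 A B C =>
    rw [frowVal, e3val_val19]
    rw [FRow.valid, Bool.or_eq_true] at hr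
    rcases hr with h | h
    · rw [Bool.and_eq_true, Bool.and_eq_true, beq_iff_eq] at h
      obtain ⟨⟨rfl, hB⟩, hC⟩ := h
      exact e3_full_row_nonneg U x y b c w hB hC
    · exact e3_star_row U x y b c w h hS0 hS1

end IncStarTwoCut.FarCert

end Summit.CriticalPhenomena.PercolationContinuityZ3.Theorems
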